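import Literature.Geometry.Lorentzian.CoordCurvatureDerivatives
import Literature.Geometry.Lorentzian.CoordFrameEvaluation
import HarnessLib

/-!
# The round defect tensor `Rm − a (g ⊙ g)` in coordinates: algebra and covariant constancy of `g ⊙ g`

Support file (everything PROVED; no definition, no named fact) for **Hamilton 1982, §17**
(smooth convergence of the normalised Ricci flow to the round metric; the evolution of the
"round defect" `|Rm − (R₀/(n(n−1))) g ⊙ g|²`, Thm. 17.6) in the chart calculus of `MetricCoord`,
wanted by the crux `ChangGurskyYang` of route `SmoothPoincare4/EntropyRung`
(item stmt-SmoothPoincare4-10834, line `margerin-cone-hamilton-rails`, stub `stub_smoothRoundLimit`).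

The Kulkarni–Nomizu square of the metric is handled as a component array
`A_{ijkl} = g_{il} g_{jk} − g_{ik} g_{jl}` (hypothesis `hA`, the slot convention of `rm4`:
`⟨Rm, A⟩ = 2S`), without introducing a definition:

* `frameComp_bilin`, `frameComp_bilinProd₀₃`, `frameComp_bilinProd₀₂` — multilinear evaluation
  of the arrays `B(b_{I₀}, b_{I₁})`, `B(b_{I₀}, b_{I₃}) C(b_{I₁}, b_{I₂})`, `B(b_{I₀}, b_{I₂}) C(b_{I₁}, b_{I₃})`;
* `tnormSq_metric2` (`|g|² = n`), `tnormSq_ggKN` (`|A|² = 2n(n−1)`), `tinner_rm4_ggKN`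
  (`⟨Rm, A⟩ = 2S`), `tnormSq_rm4_sub_smul_ggKN` (`|Rm − cA|² = |Rm|² − 4cS + 2n(n−1)c²`);
* `IsMetricOn.tcov_metric2`, `IsMetricOn.tcov_ggKN`, `IsMetricOn.tlap_ggKN` — `∇g = 0`, hence
  `∇A = 0` and `ΔA = 0` (O'Neill 1983, Ch. 3, Prop. 3.13).

## References

* R. S. Hamilton, *Three-manifolds with positive Ricci curvature*, J. Differential Geom. 17 (1982)
  255–306, §17, Lemma 17.5, Thm. 17.6. [Hamilton1982]
* B. O'Neill, *Semi-Riemannian geometry with applications to relativity*, Academic Press 1983,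
  Ch. 2, Lemma 2.25 ff.; Ch. 3, Prop. 3.13, Lemma 3.52, Def. 3.53. [ONeill1983]
* P. Topping, *Lectures on the Ricci flow*, LMS Lecture Note Series 325, CUP 2006, §2.1, §3.2.
  [Topping2006]
-/

noncomputable section

set_option maxSynthPendingDepth 3

open Set Filter ContinuousLinearMap Module Function
open scoped Topology ContDiff

namespace Literature.Geometry.Lorentzian

namespace MetricCoord

variable {E : Type*} [NormedAddCommGroup E] [NormedSpace ℝ E] {ι : Type*}

/-! ### Sums over index vectors of length two and four; frame evaluation of product arrays -/

section Frame

variable [Fintype ι] (b : Basis ι ℝ E)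

omit [Fintype ι] in
/-- Sums over index functions on `Fin 2` as double sums. [folklore] -/
theorem sum_fin2Index {κ : Type*} [Fintype κ] {R : Type*} [AddCommMonoid R] (F : (Fin 2 → κ) → R) :
    ∑ K : Fin 2 → κ, F K = ∑ a, ∑ c, F ![a, c] := by
  rw [sum_finSuccIndex]
  refine Finset.sum_congr rfl fun a _ ↦ ?_
  rw [sum_finSuccIndex]
  refine Finset.sum_congr rfl fun c _ ↦ ?_
  rw [Fintype.sum_unique]
  rfl

omit [Fintype ι] in
/-- Sums over index functions on `Fin 4` as fourfold sums. [folklore] -/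
theorem sum_fin4Index {κ : Type*} [Fintype κ] {R : Type*} [AddCommMonoid R] (F : (Fin 4 → κ) → R) :
    ∑ K : Fin 4 → κ, F K = ∑ a, ∑ c, ∑ i, ∑ j, F ![a, c, i, j] := by
  rw [sum_finSuccIndex]
  refine Finset.sum_congr rfl fun a _ ↦ ?_
  rw [sum_finSuccIndex]
  refine Finset.sum_congr rfl fun c _ ↦ ?_
  rw [sum_fin2Index]
  rfl

/-- **Bilinear arrays evaluate to the bilinear form**: for `T_I = B(b_{I₀}, b_{I₁})`,
`frameComp b T v = B(v₀, v₁)`. [cite: ONeill1983, Ch. 2, Lemma 2.3] -/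
theorem frameComp_bilin (B : E →L[ℝ] E →L[ℝ] ℝ) (v : Fin 2 → E) :
    frameComp b (fun I : Fin 2 → ι ↦ B (b (I 0)) (b (I 1))) v = B (v 0) (v 1) := by
  rw [frameComp_apply, sum_fin2Index]
  simp only [Fin.prod_univ_two, Matrix.cons_val_zero, Matrix.cons_val_one]
  conv_rhs => rw [← b.sum_repr (v 0), ← b.sum_repr (v 1)]
  simp only [map_sum, map_smul, FunLike.coe_sum, FunLike.coe_smul, Finset.sum_apply,
    Pi.smul_apply, smul_eq_mul, Finset.mul_sum, Basis.coord_apply]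
  rw [Finset.sum_comm]
  exact Finset.sum_congr rfl fun a _ ↦ Finset.sum_congr rfl fun c _ ↦ by ring

/-- **Products of two bilinear forms in the slots `(0,3)`, `(1,2)` evaluate multilinearly**:
for `T_I = B(b_{I₀}, b_{I₃}) C(b_{I₁}, b_{I₂})`, `frameComp b T v = B(v₀, v₃) C(v₁, v₂)`.
[cite: ONeill1983, Ch. 2, Lemma 2.3] -/
theorem frameComp_bilinProd₀₃ (B C : E →L[ℝ] E →L[ℝ] ℝ) (v : Fin 4 → E) :
    frameComp b (fun I : Fin 4 → ι ↦ B (b (I 0)) (b (I 3)) * C (b (I 1)) (b (I 2))) v =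
      B (v 0) (v 3) * C (v 1) (v 2) := by
  have h0 : ∀ v1 v2 v3 : E, IsLinearMap ℝ fun u ↦ B u v3 * C v1 v2 := fun v1 v2 v3 ↦
    ⟨fun x y ↦ by simp only [map_add, _root_.add_apply]; ring,
     fun c x ↦ by simp only [map_smul, FunLike.coe_smul, Pi.smul_apply, smul_eq_mul]; ring⟩
  have h1 : ∀ v0 v2 v3 : E, IsLinearMap ℝ fun u ↦ B v0 v3 * C u v2 := fun v0 v2 v3 ↦
    ⟨fun x y ↦ by simp only [map_add, _root_.add_apply]; ring,
     fun c x ↦ by simp only [map_smul, FunLike.coe_smul, Pi.smul_apply, smul_eq_mul]; ring⟩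
  have h2 : ∀ v0 v1 v3 : E, IsLinearMap ℝ fun u ↦ B v0 v3 * C v1 u := fun v0 v1 v3 ↦
    ⟨fun x y ↦ by simp only [map_add]; ring, fun c x ↦ by simp only [map_smul, smul_eq_mul]; ring⟩
  have h3 : ∀ v0 v1 v2 : E, IsLinearMap ℝ fun u ↦ B v0 u * C v1 v2 := fun v0 v1 v2 ↦
    ⟨fun x y ↦ by simp only [map_add]; ring, fun c x ↦ by simp only [map_smul, smul_eq_mul]; ring⟩
  exact frameComp_multilinear b (MultilinearMap.ofFin4 (fun v0 v1 v2 v3 ↦ B v0 v3 * C v1 v2) h0 h1 h2 h3) v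

/-- **Products of two bilinear forms in the slots `(0,2)`, `(1,3)` evaluate multilinearly**:
for `T_I = B(b_{I₀}, b_{I₂}) C(b_{I₁}, b_{I₃})`, `frameComp b T v = B(v₀, v₂) C(v₁, v₃)`.
[cite: ONeill1983, Ch. 2, Lemma 2.3] -/
theorem frameComp_bilinProd₀₂ (B C : E →L[ℝ] E →L[ℝ] ℝ) (v : Fin 4 → E) :
    frameComp b (fun I : Fin 4 → ι ↦ B (b (I 0)) (b (I 2)) * C (b (I 1)) (b (I 3))) v =
      B (v 0) (v 2) * C (v 1) (v 3) := by
  have h0 : ∀ v1 v2 v3 : E, IsLinearMap ℝ fun u ↦ B u v2 * C v1 v3 := fun v1 v2 v3 ↦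
    ⟨fun x y ↦ by simp only [map_add, _root_.add_apply]; ring,
     fun c x ↦ by simp only [map_smul, FunLike.coe_smul, Pi.smul_apply, smul_eq_mul]; ring⟩
  have h1 : ∀ v0 v2 v3 : E, IsLinearMap ℝ fun u ↦ B v0 v2 * C u v3 := fun v0 v2 v3 ↦
    ⟨fun x y ↦ by simp only [map_add, _root_.add_apply]; ring,
     fun c x ↦ by simp only [map_smul, FunLike.coe_smul, Pi.smul_apply, smul_eq_mul]; ring⟩
  have h2 : ∀ v0 v1 v3 : E, IsLinearMap ℝ fun u ↦ B v0 u * C v1 v3 := fun v0 v1 v3 ↦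
    ⟨fun x y ↦ by simp only [map_add]; ring, fun c x ↦ by simp only [map_smul, smul_eq_mul]; ring⟩
  have h3 : ∀ v0 v1 v2 : E, IsLinearMap ℝ fun u ↦ B v0 v2 * C v1 u := fun v0 v1 v2 ↦
    ⟨fun x y ↦ by simp only [map_add]; ring, fun c x ↦ by simp only [map_smul, smul_eq_mul]; ring⟩
  exact frameComp_multilinear b (MultilinearMap.ofFin4 (fun v0 v1 v2 v3 ↦ B v0 v2 * C v1 v3) h0 h1 h2 h3) v

omit [Fintype ι] in
/-- `frameComp` is compatible with differences of arrays. [folklore] -/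
theorem frameComp_sub' [Fintype ι] {α : Type*} [Fintype α] [DecidableEq α] (S₀ T₀ : (α → ι) → ℝ) (v : α → E) :
    frameComp b (S₀ - T₀) v = frameComp b S₀ v - frameComp b T₀ v := by
  simp only [frameComp_apply, Pi.sub_apply, mul_sub, Finset.sum_sub_distrib]

end Frame

/-! ### Two combinatorial sums in an orthonormal frame -/

section Comb

/-- `Σ_{acij} (δ_{aj}δ_{ci} − δ_{ai}δ_{cj})² = 2n(n−1)` (the squared norm of `g ⊙ g` in an
orthonormal frame). [folklore] -/
theorem sum_sq_delta_antisym {κ : Type*} [Fintype κ] [DecidableEq κ] :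
    ∑ a : κ, ∑ c : κ, ∑ i : κ, ∑ j : κ,
      ((if a = j then (1 : ℝ) else 0) * (if c = i then 1 else 0)
        - (if a = i then 1 else 0) * (if c = j then 1 else 0)) ^ 2 =
      2 * (Fintype.card κ : ℝ) * (Fintype.card κ - 1) := by
  have hinner : ∀ a c : κ, ∑ i : κ, ∑ j : κ,
      ((if a = j then (1 : ℝ) else 0) * (if c = i then 1 else 0)
        - (if a = i then 1 else 0) * (if c = j then 1 else 0)) ^ 2 = if a = c then 0 else 2 := by
    intro a c
    by_cases hac : a = c
    · subst hac
      rw [if_pos rfl]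
      exact Finset.sum_eq_zero fun i _ ↦ Finset.sum_eq_zero fun j _ ↦ by ring
    · rw [if_neg hac]
      have hpt : ∀ i j : κ, ((if a = j then (1 : ℝ) else 0) * (if c = i then 1 else 0)
          - (if a = i then 1 else 0) * (if c = j then 1 else 0)) ^ 2 =
          (if a = j then (1 : ℝ) else 0) * (if c = i then 1 else 0)
            + (if a = i then 1 else 0) * (if c = j then 1 else 0) := by
        intro i j
        split_ifs <;> grind
      simp only [hpt]
      simp only [Finset.sum_add_distrib, mul_ite, mul_one, mul_zero, Finset.sum_ite_irrel,
        Finset.sum_ite_eq, Finset.mem_univ, if_true, Finset.sum_const_zero]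
      norm_num
  simp only [hinner]
  have hrow : ∀ a : κ, ∑ c : κ, (if a = c then (0 : ℝ) else 2) = 2 * Fintype.card κ - 2 := by
    intro a
    have h : ∀ c : κ, (if a = c then (0 : ℝ) else 2) = 2 - (if a = c then 2 else 0) := by
      intro c; split_ifs <;> norm_num
    simp only [h, Finset.sum_sub_distrib, Finset.sum_const, Finset.card_univ, nsmul_eq_mul,
      Finset.sum_ite_eq, Finset.mem_univ, if_true]
    ring
  simp only [hrow, Finset.sum_const, Finset.card_univ, nsmul_eq_mul]
  ring

/-- `Σ_{acij} F(a,c,i,j)(δ_{aj}δ_{ci} − δ_{ai}δ_{cj}) = Σ_{ac} F(a,c,c,a) − Σ_{ac} F(a,c,a,c)`.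
[folklore] -/
theorem sum_mul_delta_antisym {κ : Type*} [Fintype κ] [DecidableEq κ] (F : κ → κ → κ → κ → ℝ) :
    ∑ a : κ, ∑ c : κ, ∑ i : κ, ∑ j : κ, F a c i j *
      ((if a = j then (1 : ℝ) else 0) * (if c = i then 1 else 0)
        - (if a = i then 1 else 0) * (if c = j then 1 else 0)) =
      ∑ a : κ, ∑ c : κ, F a c c a - ∑ a : κ, ∑ c : κ, F a c a c := by
  simp only [mul_sub, Finset.sum_sub_distrib]
  congr 1
  · refine Finset.sum_congr rfl fun a _ ↦ Finset.sum_congr rfl fun c _ ↦ ?_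
    simp only [mul_ite, mul_zero, mul_one, Finset.sum_ite_irrel, Finset.sum_ite_eq, Finset.mem_univ,
      if_true, Finset.sum_const_zero]
  · refine Finset.sum_congr rfl fun a _ ↦ Finset.sum_congr rfl fun c _ ↦ ?_
    simp only [mul_ite, mul_zero, mul_one, Finset.sum_ite_eq, Finset.mem_univ, if_true]

end Comb

/-! ### The arrays `g_{ij}` and `A = g ⊙ g`: frame evaluation, norms, the contraction with `Rm` -/

section MetricArrays

variable [Fintype ι] {G : E → E →L[ℝ] E →L[ℝ] ℝ} (b : Basis ι ℝ E) {V : Set E} {x : E}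
  [FiniteDimensional ℝ E] {A : E → (Fin 4 → ι) → ℝ}
  (hA : ∀ y J, A y J = G y (b (J 0)) (b (J 3)) * G y (b (J 1)) (b (J 2))
    - G y (b (J 0)) (b (J 2)) * G y (b (J 1)) (b (J 3)))

omit [FiniteDimensional ℝ E] in
include hA in
/-- **The Kulkarni–Nomizu array of the metric evaluates multilinearly**:
`A(v) = G(v₀,v₃)G(v₁,v₂) − G(v₀,v₂)G(v₁,v₃)`. [cite: ONeill1983, Ch. 2, Lemma 2.3] -/
theorem frameComp_ggKN (v : Fin 4 → E) :
    frameComp b (A x) v = G x (v 0) (v 3) * G x (v 1) (v 2) - G x (v 0) (v 2) * G x (v 1) (v 3) := by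
  have h : A x = (fun I : Fin 4 → ι ↦ G x (b (I 0)) (b (I 3)) * G x (b (I 1)) (b (I 2)))
      - fun I ↦ G x (b (I 0)) (b (I 2)) * G x (b (I 1)) (b (I 3)) := funext fun I ↦ hA x I
  rw [h, frameComp_sub', frameComp_bilinProd₀₃, frameComp_bilinProd₀₂]

variable (hs : ∀ v w, G x v w = G x w v) (hpos : ∀ v, v ≠ 0 → 0 < G x v v)
include hs hpos

/-- `|S − T| ≤ |S| + |T|`. [folklore] -/
theorem sqrt_tnormSq_sub_le {α : Type*} [Fintype α] [DecidableEq α] (S T : E → (α → ι) → ℝ) :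
    Real.sqrt (tnormSq G b (S - T) x) ≤ Real.sqrt (tnormSq G b S x) + Real.sqrt (tnormSq G b T x) := by
  rw [sub_eq_add_neg]
  refine (sqrt_tnormSq_add_le b hs hpos S (-T)).trans ?_
  rw [tnormSq_neg]

/-- **`|g|² = n`**: the squared norm of the metric as a rank-two array is the dimension.
[cite: ONeill1983, Ch. 3, p. 60] -/
theorem tnormSq_metric2 : tnormSq G b (fun y (I : Fin 2 → ι) ↦ G y (b (I 0)) (b (I 1))) x = Fintype.card ι := by
  obtain ⟨e, he⟩ := exists_orthonormal_basis hs hpos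
  have hi := isInvertible_of_pos hpos
  have hn : (Fintype.card (Fin (finrank ℝ E)) : ℝ) = Fintype.card ι := by
    rw [Fintype.card_fin, finrank_eq_card_basis b]
  have hf : ∀ K : Fin 2 → Fin (finrank ℝ E),
      frameComp b (fun I : Fin 2 → ι ↦ G x (b (I 0)) (b (I 1))) (e ∘ K) = G x (e (K 0)) (e (K 1)) :=
    fun K ↦ frameComp_bilin b (G x) (e ∘ K)
  have hsq : ∀ a c : Fin (finrank ℝ E), (if a = c then (1 : ℝ) else 0) ^ 2 = if a = c then 1 else 0 := by
    intro a c; split_ifs <;> norm_num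
  rw [tnormSq_eq_sum_sq_frame b e he hi hs, sum_fin2Index]
  simp only [hf, Matrix.cons_val_zero, Matrix.cons_val_one, he, hsq, Finset.sum_ite_eq,
    Finset.mem_univ, if_true, Finset.sum_const, Finset.card_univ, nsmul_eq_mul, mul_one, hn]

include hA

/-- **`|g ⊙ g|² = 2n(n−1)`** for the Kulkarni–Nomizu array `A` of the metric.
[cite: Hamilton1982, §17, Lemma 17.5] -/
theorem tnormSq_ggKN : tnormSq G b A x = 2 * (Fintype.card ι : ℝ) * (Fintype.card ι - 1) := by
  obtain ⟨e, he⟩ := exists_orthonormal_basis hs hpos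
  have hi := isInvertible_of_pos hpos
  have hn : (Fintype.card (Fin (finrank ℝ E)) : ℝ) = Fintype.card ι := by
    rw [Fintype.card_fin, finrank_eq_card_basis b]
  rw [tnormSq_eq_sum_sq_frame b e he hi hs, sum_fin4Index]
  simp only [frameComp_ggKN b hA, Function.comp_apply, Matrix.cons_val_zero, Matrix.cons_val_one,
    Matrix.cons_val, he]
  rw [sum_sq_delta_antisym, hn]

/-- **`⟨Rm, g ⊙ g⟩ = 2S`**: the full contraction of the curvature array with the Kulkarni–Nomizu
array of the metric is twice the scalar curvature (`R(X,Y) = −R(Y,X)`, `S = Σ Ric(e_c,e_c)`).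
[cite: ONeill1983, Ch. 3, Def. 3.53] -/
theorem tinner_rm4_ggKN : tinner G b (rm4 G b) A x = 2 * scalAt G x := by
  classical
  obtain ⟨e, he⟩ := exists_orthonormal_basis hs hpos
  have hi := isInvertible_of_pos hpos
  rw [tinner_eq_sum_frame b e he hi hs, sum_fin4Index]
  simp only [frameComp_rm4, frameComp_ggKN b hA, Function.comp_apply, Matrix.cons_val_zero,
    Matrix.cons_val_one, Matrix.cons_val, he]
  rw [sum_mul_delta_antisym]
  have hscal : ∑ a, ∑ c, G x (riemAt G x (e c) (e a) (e a)) (e c) = scalAt G x := by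
    rw [scalAt_eq_sum e]
    refine Finset.sum_congr rfl fun a _ ↦ ?_
    rw [sum_ginv_mul_of_orthonormal e he hi (fun l ↦ ricAt G x (e a) (e l)) a,
      ricAt_eq_sum_of_orthonormal e he]
  have hswap : ∀ a c, G x (riemAt G x (e a) (e c) (e a)) (e c) = -G x (riemAt G x (e c) (e a) (e a)) (e c) := by
    intro a c
    rw [riemAt_swap G x (e c) (e a), _root_.neg_apply, map_neg, _root_.neg_apply]
  simp only [hswap, Finset.sum_neg_distrib, sub_neg_eq_add]
  rw [Finset.sum_comm, hscal]
  ring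

/-- **`|Rm − c (g ⊙ g)|² = |Rm|² − 4cS + 2n(n−1)c²`.** [cite: Hamilton1982, §17, Lemma 17.5] -/
theorem tnormSq_rm4_sub_smul_ggKN (c : ℝ) :
    tnormSq G b (rm4 G b - c • A) x =
      tnormSq G b (rm4 G b) x - 4 * c * scalAt G x + 2 * Fintype.card ι * (Fintype.card ι - 1) * c ^ 2 := by
  have hi := isInvertible_of_pos hpos
  have hgs : ∀ i j, ginv G b x i j = ginv G b x j i := fun i j ↦ ginv_comm b hi hs i j
  have hexp : tnormSq G b (rm4 G b - c • A) x =
      tnormSq G b (rm4 G b) x - 2 * c * tinner G b (rm4 G b) A x + c ^ 2 * tnormSq G b A x := by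
    simp only [tnormSq_eq, tinner_sub_left, tinner_sub_right, tinner_smul_left, tinner_smul_right,
      tinner_comm hgs A (rm4 G b)]
    ring
  rw [hexp, tinner_rm4_ggKN b hA hs hpos, tnormSq_ggKN b hA hs hpos]
  ring

omit hs hpos

/-! ### `∇g = 0`, `∇(g ⊙ g) = 0`, `Δ(g ⊙ g) = 0` -/

variable [CompleteSpace E]

omit hA [FiniteDimensional ℝ E] [Fintype ι] [CompleteSpace E] in
/-- The metric array is smooth on `V`. [folklore] -/
theorem IsMetricOn.tsmoothOn_metric2 (hG : IsMetricOn G V) :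
    TSmoothOn (fun y (I : Fin 2 → ι) ↦ G y (b (I 0)) (b (I 1))) V := fun _ ↦
  (hG.contDiffOn.clm_apply contDiffOn_const).clm_apply contDiffOn_const

omit [FiniteDimensional ℝ E] [Fintype ι] [CompleteSpace E] in
/-- The Kulkarni–Nomizu array of the metric is smooth on `V`. [folklore] -/
theorem IsMetricOn.tsmoothOn_ggKN (hG : IsMetricOn G V) : TSmoothOn A V := by
  intro J
  have h : ∀ i j, ContDiffOn ℝ ∞ (fun y ↦ G y (b i) (b j)) V := fun i j ↦
    (hG.contDiffOn.clm_apply contDiffOn_const).clm_apply contDiffOn_const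
  have hfun : (fun y ↦ A y J) = fun y ↦ G y (b (J 0)) (b (J 3)) * G y (b (J 1)) (b (J 2))
      - G y (b (J 0)) (b (J 2)) * G y (b (J 1)) (b (J 3)) := funext fun y ↦ hA y J
  rw [hfun]
  exact ((h _ _).mul (h _ _)).sub ((h _ _).mul (h _ _))

omit hA [FiniteDimensional ℝ E] in
/-- **`∇g = 0` in the component calculus**: the covariant derivative of the metric array
vanishes (O'Neill 1983, Ch. 3, Prop. 3.13). [cite: ONeill1983, Ch. 3, Prop. 3.13] -/
theorem IsMetricOn.tcov_metric2 (hG : IsMetricOn G V) (hx : x ∈ V) (J : Option (Fin 2) → ι) :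
    tcov G b (fun y (I : Fin 2 → ι) ↦ G y (b (I 0)) (b (I 1))) x J = 0 := by
  have hJ : J = ocons (J none) (pair (J (some 0)) (J (some 1))) := by
    funext o
    rcases o with _ | c
    · rfl
    · fin_cases c <;> rfl
  rw [hJ, tcov_apply_ocons, Fin.sum_univ_two]
  simp only [pair_zero, pair_one, update_pair_zero, update_pair_one]
  rw [hG.fderiv_metric_apply_basis hx, Finset.sum_add_distrib]
  ring

omit [FiniteDimensional ℝ E] in
/-- `∇(g ⊙ g) = 0` on explicit index vectors. [cite: ONeill1983, Ch. 3, Prop. 3.13] -/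
theorem IsMetricOn.tcov_ggKN_vec (hG : IsMetricOn G V) (hx : x ∈ V) (q i j k l : ι) :
    tcov G b A x (ocons q ![i, j, k, l]) = 0 := by
  have hd : ∀ i' j' : ι, DifferentiableAt ℝ (fun y ↦ G y (b i') (b j')) x := fun i' j' ↦
    (((hG.contDiffOn.clm_apply contDiffOn_const).clm_apply contDiffOn_const).contDiffAt
      (hG.isOpen.mem_nhds hx)).differentiableAt (by simp)
  rw [tcov_apply_ocons, Fin.sum_univ_four]
  simp only [Matrix.cons_val_zero, Matrix.cons_val_one, Matrix.cons_val, update_vec4_zero,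
    update_vec4_one, update_vec4_two, update_vec4_three, hA]
  rw [fderiv_fun_sub (by exact (hd _ _).mul (hd _ _)) (by exact (hd _ _).mul (hd _ _)),
    fderiv_fun_mul (hd _ _) (hd _ _), fderiv_fun_mul (hd _ _) (hd _ _)]
  simp only [_root_.sub_apply, _root_.add_apply, FunLike.coe_smul, Pi.smul_apply,
    smul_eq_mul, hG.fderiv_metric_apply_basis hx]
  simp only [Finset.mul_sum, mul_add, mul_sub, ← Finset.sum_add_distrib, ← Finset.sum_sub_distrib]
  exact Finset.sum_eq_zero fun m _ ↦ by ring

omit [FiniteDimensional ℝ E] in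
/-- **`∇(g ⊙ g) = 0`**: the Kulkarni–Nomizu array of the metric is parallel.
[cite: ONeill1983, Ch. 3, Prop. 3.13] -/
theorem IsMetricOn.tcov_ggKN (hG : IsMetricOn G V) (hx : x ∈ V) (J : Option (Fin 4) → ι) :
    tcov G b A x J = 0 := by
  have hJ : J = ocons (J none) ![J (some 0), J (some 1), J (some 2), J (some 3)] := by
    funext o
    rcases o with _ | c
    · rfl
    · fin_cases c <;> rfl
  rw [hJ]
  exact hG.tcov_ggKN_vec b hA hx _ _ _ _ _

/-- **`Δ(g ⊙ g) = 0`.** [cite: ONeill1983, Ch. 3, Prop. 3.13] -/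
theorem IsMetricOn.tlap_ggKN (hG : IsMetricOn G V) (hx : x ∈ V) (I : Fin 4 → ι) : tlap G b A x I = 0 := by
  rw [tlap_apply]
  have h1 : ∀ J, tcov G b (tcov G b A) x J = 0 := fun J ↦ by
    rw [tcov_congr hG.isOpen (S := tcov G b A) (T := 0) (fun y hy J' ↦ hG.tcov_ggKN b hA hy J') hx,
      tcov_zero]
    rfl
  simp only [h1, mul_zero, Finset.sum_const_zero]

omit [FiniteDimensional ℝ E] in
/-- `∇(Rm − cA) = ∇Rm` at points of `V`. [cite: Hamilton1982, §17, Lemma 17.5] -/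
theorem IsMetricOn.tcov_rm4_sub_smul_ggKN (hG : IsMetricOn G V) (hx : x ∈ V) (c : ℝ)
    (J : Option (Fin 4) → ι) : tcov G b (rm4 G b - c • A) x J = tcov G b (rm4 G b) x J := by
  rw [tcov_sub_apply hG.isOpen (hG.tsmoothOn_rm4 b) ((hG.tsmoothOn_ggKN b hA).smul c) hx,
    tcov_smul_apply hG.isOpen (hG.tsmoothOn_ggKN b hA) c hx, hG.tcov_ggKN b hA hx]
  ring

/-- `Δ(Rm − cA) = ΔRm` at points of `V`. [cite: Hamilton1982, §17, Lemma 17.5] -/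
theorem IsMetricOn.tlap_rm4_sub_smul_ggKN (hG : IsMetricOn G V) (hx : x ∈ V) (c : ℝ) (I : Fin 4 → ι) :
    tlap G b (rm4 G b - c • A) x I = tlap G b (rm4 G b) x I := by
  rw [tlap_apply, tlap_apply]
  refine Finset.sum_congr rfl fun j _ ↦ Finset.sum_congr rfl fun k _ ↦ ?_
  rw [tcov_congr hG.isOpen (fun y hy J ↦ hG.tcov_rm4_sub_smul_ggKN b hA hy c J) hx]

end MetricArrays

end MetricCoord

end Literature.Geometry.Lorentzian

end
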